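import Summits.Parity.GeneralizedHardyLittlewood.Theorems.PrimeLevelFamEdgeMomentsBeyondDiagonalDiagDecorWeightOneOne
import Summits.Parity.GeneralizedHardyLittlewood.Theorems.PrimeLevelFamEdgeMomentsBeyondDiagonalDiagBoseOuter
import HarnessLib

/-!
# Route `PrimeLevelFamEdge`, crux K_A `MomentsBeyondDiagonal` (stmt-Parity-20007), line «petersson_layers» v4, stub `stub_diag`:
# **the order-`(1,1)` decorated Selberg form AFTER the Hecke summation, exactly:
# `Sel₁₁ = Sel(τ(k₁)τ(k₂)·{(L²/4 − (P₂(k₁)+P₂(k₂))/4)·c₀₀ + (L/2)(c₀₁ + c₁₀) + c₁₁}(g²k₁k₂/Q²))`**, `L = 2(log Q − log g) − log k₁ − log k₂`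

Census R3(ii), bridge item 5 of `Cruxes/MomentsBeyondDiagonal/Lines/petersson_layers_stub_diag_g10_blocks.md`: the
order-`(1,1)` form of `…DiagOrderSelberg.subDiag_of_selbergOrderAsymptotics` (weight
`Σ_{d∣k₁}Σ_{e∣k₂}∫(log(Q/n₁)+log u₁)∫B(φ)(log(Q/n₂)+log u₂)`, `n₁ = (k₁/d)(ge)`, `n₂ = (gd)(k₂/e)`) equals, EXACTLY, the
product-form Selberg sum with the weight displayed above, where `c_ab(y) = ∫_{u₁>0}(log u₁)^a∫_{u₂>y/u₁}B(log u₂)^b` are the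
Bose coefficients (`…DiagBoseOuter.bose_expand` pointwise + the weight algebra of `…DiagDecorWeightOneOne`; only squarefree
`k₁,k₂` count, `selbergForm_congr_squarefree`). Splitting `c_ab = Π_ab(L) + E_ab + r_ab` (`…DiagBoseMixedStructure`,
`μ₀ = 1/4`: `…DiagDecorBoseMuZero`) turns the polynomial part into the input of `…DiagDecorOrderOneOnePoly` and leaves the
remainder part for the corner pipeline.

* `heckeSum_orderOneOne_eq` — pointwise (`Q > 0`, `g ≥ 1`, `k₁, k₂` squarefree);
* `selbergOrderOneOne_hecke_eq` — **the exact identity of Selberg forms** (`Q > 0`, any `M`, `N`).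

Def-free; theorems only. Helper `--supports stmt-Parity-20007`; closes nothing; K_A, K_B and the Parity summit are NOT
proved; nothing about Landau–Siegel zeros.

## References
* E. Kowalski, P. Michel, J. VanderKam, J. reine angew. Math. 526 (2000), (21)–(28) pp. 12–15.
  [cite: KowalskiMichelVanderKam2000, (23)–(28) — derivation (Hecke-divisor bookkeeping of the order-(1,1) diagonal weight)]
-/

noncomputable section

open scoped Real ArithmeticFunction.Moebius
open Finset ArithmeticFunction Polynomial MeasureTheory Set

namespace Summit.Parity.GeneralizedHardyLittlewood.Theorems.MomentsBeyondDiagonal.DiagKernel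

open Literature.NumberTheory.LFunctions Literature.NumberTheory.LFunctions.KMV2000
open Summit.Parity.GeneralizedHardyLittlewood.Theorems.MomentsBeyondDiagonal.DiagLines (bose_expand)

/-- **The Hecke sum of the order-`(1,1)` weight, pointwise** (`Q > 0`, `g ≥ 1`, `k₁, k₂` squarefree):
`Σ_{d∣k₁}Σ_{e∣k₂}𝔚₁₁(log(Q/n₁),log(Q/n₂);n₁n₂/Q²) = τ(k₁)τ(k₂)·{(L²/4 − ΣP₂/4)c₀₀ + (L/2)(c₀₁+c₁₀) + c₁₁}(g²k₁k₂/Q²)`.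
[cite: KowalskiMichelVanderKam2000, (23)–(28) — derivation] -/
theorem heckeSum_orderOneOne_eq {Q : ℝ} (hQ : 0 < Q) {g k₁ k₂ : ℕ} (hg : g ≠ 0) (hk₁ : Squarefree k₁)
    (hk₂ : Squarefree k₂) :
    ∑ d ∈ k₁.divisors, ∑ e ∈ k₂.divisors,
        ∫ u₁ in Ioi (0 : ℝ),
          (Real.log (Q / ((k₁ / d * (g * e) : ℕ) : ℝ)) + Real.log u₁) ^ 1 *
          ∫ u₂ in Ioi ((((k₁ / d * (g * e) * (g * d * (k₂ / e)) : ℕ) : ℝ) / Q ^ 2) / u₁),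
            Real.exp (-(u₁ + u₂)) / (1 - Real.exp (-(u₁ + u₂))) ^ 2 *
            (Real.log (Q / ((g * d * (k₂ / e) : ℕ) : ℝ)) + Real.log u₂) ^ 1 =
      (k₁.divisors.card : ℝ) * (k₂.divisors.card : ℝ) *
        (((2 * (Real.log Q - Real.log g) - Real.log k₁ - Real.log k₂) ^ 2 / 4 -
            ((∑ p ∈ k₁.primeFactors, Real.log p ^ 2) + ∑ p ∈ k₂.primeFactors, Real.log p ^ 2) / 4) *
          (∫ u₁ in Ioi (0 : ℝ), ∫ u₂ in Ioi ((((g * g * (k₁ * k₂) : ℕ) : ℝ) / Q ^ 2) / u₁),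
            Real.exp (-(u₁ + u₂)) / (1 - Real.exp (-(u₁ + u₂))) ^ 2) +
        (2 * (Real.log Q - Real.log g) - Real.log k₁ - Real.log k₂) / 2 *
          ((∫ u₁ in Ioi (0 : ℝ), ∫ u₂ in Ioi ((((g * g * (k₁ * k₂) : ℕ) : ℝ) / Q ^ 2) / u₁),
              Real.exp (-(u₁ + u₂)) / (1 - Real.exp (-(u₁ + u₂))) ^ 2 * Real.log u₂) +
            ∫ u₁ in Ioi (0 : ℝ), Real.log u₁ * ∫ u₂ in Ioi ((((g * g * (k₁ * k₂) : ℕ) : ℝ) / Q ^ 2) / u₁),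
              Real.exp (-(u₁ + u₂)) / (1 - Real.exp (-(u₁ + u₂))) ^ 2) +
        ∫ u₁ in Ioi (0 : ℝ), Real.log u₁ * ∫ u₂ in Ioi ((((g * g * (k₁ * k₂) : ℕ) : ℝ) / Q ^ 2) / u₁),
          Real.exp (-(u₁ + u₂)) / (1 - Real.exp (-(u₁ + u₂))) ^ 2 * Real.log u₂) := by
  have hk₁0 : k₁ ≠ 0 := hk₁.ne_zero
  have hk₂0 : k₂ ≠ 0 := hk₂.ne_zero
  -- Step 1: pointwise Bose expansion of every summand
  have hstep : ∀ d ∈ k₁.divisors, ∀ e ∈ k₂.divisors,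
      ∫ u₁ in Ioi (0 : ℝ),
          (Real.log (Q / ((k₁ / d * (g * e) : ℕ) : ℝ)) + Real.log u₁) ^ 1 *
          ∫ u₂ in Ioi ((((k₁ / d * (g * e) * (g * d * (k₂ / e)) : ℕ) : ℝ) / Q ^ 2) / u₁),
            Real.exp (-(u₁ + u₂)) / (1 - Real.exp (-(u₁ + u₂))) ^ 2 *
            (Real.log (Q / ((g * d * (k₂ / e) : ℕ) : ℝ)) + Real.log u₂) ^ 1 =
        Real.log (Q / ((k₁ / d * (g * e) : ℕ) : ℝ)) * Real.log (Q / ((g * d * (k₂ / e) : ℕ) : ℝ)) *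
            (fun K : ℕ ↦ ∫ u₁ in Ioi (0 : ℝ), ∫ u₂ in Ioi (((K : ℝ) / Q ^ 2) / u₁),
              Real.exp (-(u₁ + u₂)) / (1 - Real.exp (-(u₁ + u₂))) ^ 2) (k₁ / d * (g * e) * (g * d * (k₂ / e))) +
          Real.log (Q / ((k₁ / d * (g * e) : ℕ) : ℝ)) *
            (fun K : ℕ ↦ ∫ u₁ in Ioi (0 : ℝ), ∫ u₂ in Ioi (((K : ℝ) / Q ^ 2) / u₁),
              Real.exp (-(u₁ + u₂)) / (1 - Real.exp (-(u₁ + u₂))) ^ 2 * Real.log u₂) (k₁ / d * (g * e) * (g * d * (k₂ / e))) +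
          (Real.log (Q / ((g * d * (k₂ / e) : ℕ) : ℝ)) *
            (fun K : ℕ ↦ ∫ u₁ in Ioi (0 : ℝ), Real.log u₁ * ∫ u₂ in Ioi (((K : ℝ) / Q ^ 2) / u₁),
              Real.exp (-(u₁ + u₂)) / (1 - Real.exp (-(u₁ + u₂))) ^ 2) (k₁ / d * (g * e) * (g * d * (k₂ / e))) +
          (fun K : ℕ ↦ ∫ u₁ in Ioi (0 : ℝ), Real.log u₁ * ∫ u₂ in Ioi (((K : ℝ) / Q ^ 2) / u₁),
              Real.exp (-(u₁ + u₂)) / (1 - Real.exp (-(u₁ + u₂))) ^ 2 * Real.log u₂) (k₁ / d * (g * e) * (g * d * (k₂ / e)))) := by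
    intro d hd e he
    have hdk : d ∣ k₁ := (Nat.mem_divisors.mp hd).1
    have hek : e ∣ k₂ := (Nat.mem_divisors.mp he).1
    have hd0 : d ≠ 0 := fun h ↦ by simp [h] at hdk; omega
    have he0 : e ≠ 0 := fun h ↦ hk₂0 (Nat.eq_zero_of_zero_dvd (h ▸ hek))
    have h1 : k₁ / d ≠ 0 := fun h ↦ by have := Nat.eq_zero_of_dvd_of_div_eq_zero hdk h; omega
    have h2 : k₂ / e ≠ 0 := fun h ↦ hk₂0 (Nat.eq_zero_of_dvd_of_div_eq_zero hek h)
    have hK : (k₁ / d * (g * e) * (g * d * (k₂ / e))) ≠ 0 :=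
      mul_ne_zero (mul_ne_zero h1 (mul_ne_zero hg he0)) (mul_ne_zero (mul_ne_zero hg hd0) h2)
    have hy : 0 < (((k₁ / d * (g * e) * (g * d * (k₂ / e)) : ℕ) : ℝ) / Q ^ 2) := by
      have : (0 : ℝ) < ((k₁ / d * (g * e) * (g * d * (k₂ / e)) : ℕ) : ℝ) := by exact_mod_cast Nat.pos_of_ne_zero hK
      positivity
    rw [bose_expand hy 1 1]
    simp only [Finset.sum_range_succ, Finset.sum_range_zero, zero_add, Nat.choose_zero_right, Nat.choose_self,
      Nat.cast_one, one_mul, mul_one, Nat.sub_zero, Nat.sub_self, pow_one, pow_zero]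
  rw [Finset.sum_congr rfl fun d hd ↦ Finset.sum_congr rfl fun e he ↦ hstep d hd e he]
  -- Step 2: distribute and apply the four inner-sum identities
  simp only [Finset.sum_add_distrib]
  rw [inner_weight_A1A2_of_squarefree (fun K : ℕ ↦ ∫ u₁ in Ioi (0 : ℝ), ∫ u₂ in Ioi (((K : ℝ) / Q ^ 2) / u₁),
      Real.exp (-(u₁ + u₂)) / (1 - Real.exp (-(u₁ + u₂))) ^ 2) hQ hg hk₁ hk₂,
    inner_weight_A1 (fun K : ℕ ↦ ∫ u₁ in Ioi (0 : ℝ), ∫ u₂ in Ioi (((K : ℝ) / Q ^ 2) / u₁),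
      Real.exp (-(u₁ + u₂)) / (1 - Real.exp (-(u₁ + u₂))) ^ 2 * Real.log u₂) hQ hg hk₁0 hk₂0,
    inner_weight_A2 (fun K : ℕ ↦ ∫ u₁ in Ioi (0 : ℝ), Real.log u₁ * ∫ u₂ in Ioi (((K : ℝ) / Q ^ 2) / u₁),
      Real.exp (-(u₁ + u₂)) / (1 - Real.exp (-(u₁ + u₂))) ^ 2) hQ hg hk₁0 hk₂0,
    inner_weight_one (fun K : ℕ ↦ ∫ u₁ in Ioi (0 : ℝ), Real.log u₁ * ∫ u₂ in Ioi (((K : ℝ) / Q ^ 2) / u₁),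
      Real.exp (-(u₁ + u₂)) / (1 - Real.exp (-(u₁ + u₂))) ^ 2 * Real.log u₂) g k₁ k₂]
  ring

/-- **The order-`(1,1)` decorated Selberg form after the Hecke summation, exactly** (`Q > 0`, any `M`, `N`; see the
module docstring). [cite: KowalskiMichelVanderKam2000, (23)–(28) — derivation] -/
theorem selbergOrderOneOne_hecke_eq (P : ℝ[X]) (M : ℝ) (N : ℕ) {Q : ℝ} (hQ : 0 < Q) :
    ∑ c ∈ Icc 1 N, ∑ g ∈ Icc 1 (N / c), (μ g : ℝ) * c *
        ∑ k₁ ∈ Icc 1 (N / (c * g)), ∑ k₂ ∈ Icc 1 (N / (c * g)),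
          ((μ (c * g * k₁) : ℝ) * ((psi (c * g * k₁))⁻¹ *
              P.eval (Real.log (M / ((c * g * k₁ : ℕ) : ℝ)) / Real.log M)) / ((c * g * k₁ : ℕ) : ℝ)) *
            ((μ (c * g * k₂) : ℝ) * ((psi (c * g * k₂))⁻¹ *
              P.eval (Real.log (M / ((c * g * k₂ : ℕ) : ℝ)) / Real.log M)) / ((c * g * k₂ : ℕ) : ℝ)) *
            ∑ d ∈ k₁.divisors, ∑ e ∈ k₂.divisors,
              ∫ u₁ in Ioi (0 : ℝ),
                (Real.log (Q / ((k₁ / d * (g * e) : ℕ) : ℝ)) + Real.log u₁) ^ 1 *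
                ∫ u₂ in Ioi ((((k₁ / d * (g * e) * (g * d * (k₂ / e)) : ℕ) : ℝ) / Q ^ 2) / u₁),
                  Real.exp (-(u₁ + u₂)) / (1 - Real.exp (-(u₁ + u₂))) ^ 2 *
                  (Real.log (Q / ((g * d * (k₂ / e) : ℕ) : ℝ)) + Real.log u₂) ^ 1 =
      ∑ c ∈ Icc 1 N, ∑ g ∈ Icc 1 (N / c), (μ g : ℝ) * c *
        ∑ k₁ ∈ Icc 1 (N / (c * g)), ∑ k₂ ∈ Icc 1 (N / (c * g)),
          ((μ (c * g * k₁) : ℝ) * ((psi (c * g * k₁))⁻¹ *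
              P.eval (Real.log (M / ((c * g * k₁ : ℕ) : ℝ)) / Real.log M)) / ((c * g * k₁ : ℕ) : ℝ)) *
            ((μ (c * g * k₂) : ℝ) * ((psi (c * g * k₂))⁻¹ *
              P.eval (Real.log (M / ((c * g * k₂ : ℕ) : ℝ)) / Real.log M)) / ((c * g * k₂ : ℕ) : ℝ)) *
            ((k₁.divisors.card : ℝ) * (k₂.divisors.card : ℝ) *
              (((2 * (Real.log Q - Real.log g) - Real.log k₁ - Real.log k₂) ^ 2 / 4 -
                  ((∑ p ∈ k₁.primeFactors, Real.log p ^ 2) + ∑ p ∈ k₂.primeFactors, Real.log p ^ 2) / 4) *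
                (∫ u₁ in Ioi (0 : ℝ), ∫ u₂ in Ioi ((((g * g * (k₁ * k₂) : ℕ) : ℝ) / Q ^ 2) / u₁),
                  Real.exp (-(u₁ + u₂)) / (1 - Real.exp (-(u₁ + u₂))) ^ 2) +
              (2 * (Real.log Q - Real.log g) - Real.log k₁ - Real.log k₂) / 2 *
                ((∫ u₁ in Ioi (0 : ℝ), ∫ u₂ in Ioi ((((g * g * (k₁ * k₂) : ℕ) : ℝ) / Q ^ 2) / u₁),
                    Real.exp (-(u₁ + u₂)) / (1 - Real.exp (-(u₁ + u₂))) ^ 2 * Real.log u₂) +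
                  ∫ u₁ in Ioi (0 : ℝ), Real.log u₁ * ∫ u₂ in Ioi ((((g * g * (k₁ * k₂) : ℕ) : ℝ) / Q ^ 2) / u₁),
                    Real.exp (-(u₁ + u₂)) / (1 - Real.exp (-(u₁ + u₂))) ^ 2) +
              ∫ u₁ in Ioi (0 : ℝ), Real.log u₁ * ∫ u₂ in Ioi ((((g * g * (k₁ * k₂) : ℕ) : ℝ) / Q ^ 2) / u₁),
                Real.exp (-(u₁ + u₂)) / (1 - Real.exp (-(u₁ + u₂))) ^ 2 * Real.log u₂)) := by
  rw [selbergForm_congr_squarefree P M N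
    (fun c g k₁ k₂ ↦ ∑ d ∈ k₁.divisors, ∑ e ∈ k₂.divisors,
      ∫ u₁ in Ioi (0 : ℝ),
        (Real.log (Q / ((k₁ / d * (g * e) : ℕ) : ℝ)) + Real.log u₁) ^ 1 *
        ∫ u₂ in Ioi ((((k₁ / d * (g * e) * (g * d * (k₂ / e)) : ℕ) : ℝ) / Q ^ 2) / u₁),
          Real.exp (-(u₁ + u₂)) / (1 - Real.exp (-(u₁ + u₂))) ^ 2 *
          (Real.log (Q / ((g * d * (k₂ / e) : ℕ) : ℝ)) + Real.log u₂) ^ 1)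
    (fun c g k₁ k₂ ↦ if g = 0 then ∑ d ∈ k₁.divisors, ∑ e ∈ k₂.divisors,
      ∫ u₁ in Ioi (0 : ℝ),
        (Real.log (Q / ((k₁ / d * (g * e) : ℕ) : ℝ)) + Real.log u₁) ^ 1 *
        ∫ u₂ in Ioi ((((k₁ / d * (g * e) * (g * d * (k₂ / e)) : ℕ) : ℝ) / Q ^ 2) / u₁),
          Real.exp (-(u₁ + u₂)) / (1 - Real.exp (-(u₁ + u₂))) ^ 2 *
          (Real.log (Q / ((g * d * (k₂ / e) : ℕ) : ℝ)) + Real.log u₂) ^ 1 else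
      (k₁.divisors.card : ℝ) * (k₂.divisors.card : ℝ) *
        (((2 * (Real.log Q - Real.log g) - Real.log k₁ - Real.log k₂) ^ 2 / 4 -
            ((∑ p ∈ k₁.primeFactors, Real.log p ^ 2) + ∑ p ∈ k₂.primeFactors, Real.log p ^ 2) / 4) *
          (∫ u₁ in Ioi (0 : ℝ), ∫ u₂ in Ioi ((((g * g * (k₁ * k₂) : ℕ) : ℝ) / Q ^ 2) / u₁),
            Real.exp (-(u₁ + u₂)) / (1 - Real.exp (-(u₁ + u₂))) ^ 2) +
        (2 * (Real.log Q - Real.log g) - Real.log k₁ - Real.log k₂) / 2 *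
          ((∫ u₁ in Ioi (0 : ℝ), ∫ u₂ in Ioi ((((g * g * (k₁ * k₂) : ℕ) : ℝ) / Q ^ 2) / u₁),
              Real.exp (-(u₁ + u₂)) / (1 - Real.exp (-(u₁ + u₂))) ^ 2 * Real.log u₂) +
            ∫ u₁ in Ioi (0 : ℝ), Real.log u₁ * ∫ u₂ in Ioi ((((g * g * (k₁ * k₂) : ℕ) : ℝ) / Q ^ 2) / u₁),
              Real.exp (-(u₁ + u₂)) / (1 - Real.exp (-(u₁ + u₂))) ^ 2) +
        ∫ u₁ in Ioi (0 : ℝ), Real.log u₁ * ∫ u₂ in Ioi ((((g * g * (k₁ * k₂) : ℕ) : ℝ) / Q ^ 2) / u₁),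
          Real.exp (-(u₁ + u₂)) / (1 - Real.exp (-(u₁ + u₂))) ^ 2 * Real.log u₂))
    (fun c g k₁ k₂ h₁ h₂ ↦ by
      by_cases hg : g = 0
      · simp only [hg, if_true]
      · simp only [hg, if_false]
        exact heckeSum_orderOneOne_eq hQ hg h₁ h₂)]
  refine Finset.sum_congr rfl fun c _ ↦ Finset.sum_congr rfl fun g hg ↦ ?_
  have hg0 : g ≠ 0 := by have := (Finset.mem_Icc.1 hg).1; omega
  simp only [hg0, if_false]

end Summit.Parity.GeneralizedHardyLittlewood.Theorems.MomentsBeyondDiagonal.DiagKernel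

end
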